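import Summits.AtomisticToContinuum.HydrodynamicLimit.Theorems.SpeedCapSurgeryMaxSpeedBoundLogEquilibriumRare
import Summits.AtomisticToContinuum.HydrodynamicLimit.Theorems.SpeedCapSurgeryMaxSpeedBoundLogNonStationaryFlux
import HarnessLib

/-!
# The one-window energetic pair bound holds under the homogeneous Gibbs law (calibration of stub 3b)

Helper file of the crux line `registered` (birth skeleton) of `SpeedCapSurgery.MaxSpeedBoundLog`
(stmt-AtomisticToContinuum-9629), `--supports` that item. After the cycle-2 reshape the open,
load-bearing stub of the line is `stub_energeticWindowBound` (3b): `C ≥ 0`, tube families `S N M`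
and `B N → 0` bounding the time-Riemann sums
`liminf_M Σ_{k=1}^{M} E_{LG_N}[Σ_{i≠j} 𝟙{lift of xᵢ−xⱼ ∈ S N M (vⱼ−vᵢ)} 𝟙{C² log(N+2) < ‖vᵢ‖²+‖vⱼ‖²} ∘ Φ_{kt/M}]`
of FIXED-TIME one-window energetic pair functionals. This file proves 3b, in its exact shape, in the
CALIBRATION CASE of constant profiles `a₀ ≡ 1`, `u₀ ≡ 0`, `θ₀ ≡ θe` (the flow-invariant homogeneous
Gibbs law of `EquilibriumMaxSpeed`, stmt-9632) — the sanity certificate that the reshaped stub is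
the right shape (true on the invariant manifold of profiles, with the § Numbers rate):

* `measurableSet_liftTubeEvent`, `lintegral_indicator_liftTubeEvent_le`: the EXPLICIT one-window
  event of the stub ("some lattice lift of the minimal image of `xᵢ − xⱼ` lies in the tube
  `S (vⱼ − vᵢ)`") is measurable, and under `G_N` its `A(vᵢ,vⱼ)`-weighted probability is at most
  `C_p · 4 ε² h · ∫ ‖w − v‖ A d(N(u,θ) ⊗ N(u,θ))` for a pair law `≤ C_p ×` Haar and tubes of volume
  `≤ 4 ε² h ‖u‖` (the computation of the Literature's `exists_windowEvent_of_pairBound`, whose event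
  is this very set behind an `∃`);
* `equilibrium_energeticWindowBound`: 3b at constant profiles, `σ₀ = 1/2`: by invariance
  (`lintegral_comp_flow_localGibbsLaw_const`) every grid term is a STATIC Gibbs mean, bounded with
  `C_p = 5` (`posGibbs_pairEvent_le_five`), the swept tubes of `exists_sweptTube` and the Gaussian
  flux tail `exists_flux_tail_bound` by `(N+1)² · 5 · 4 ε_N² (t/M) · K (N+2)^{-αC²}`; with
  `α C² = 3` the `M` grid terms sum to `B N ≤ 5 t (K+1)/(N+2) → 0`
  (`liminf_sum_le_of_forall_le_div`).

References: C. Cercignani, R. Illner, M. Pulvirenti, *The Mathematical Theory of Dilute Gases*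
(1994), App. 4.A; H. Spohn, *Large Scale Dynamics of Interacting Particles* (1991), Part I §2.3.
-/

noncomputable section

open MeasureTheory ProbabilityTheory Set Filter Topology
open scoped ENNReal InnerProductSpace BigOperators

namespace Summit.AtomisticToContinuum.HydrodynamicLimit.Theorems.MaxSpeedBoundLogLine

open Literature.MathematicalPhysics.KineticTheory Literature.Analysis.FluidPDE Literature.Analysis.FunctionSpaces
open Summit.AtomisticToContinuum.HydrodynamicLimit.Theorems.EnergyCurrentTailsLevelCensus
open Summit.AtomisticToContinuum.HydrodynamicLimit.Theorems

/-! ## The explicit one-window event: measurability and the static Gibbs bound -/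

/-- The one-window event of the stub — "some lattice lift of the minimal image of `xᵢ − xⱼ` lies in
the tube `S (vⱼ − vᵢ)`" — is measurable for a tube family with measurable graph. -/
theorem measurableSet_liftTubeEvent {N : ℕ} {S : V3 → Set V3}
    (hSm : MeasurableSet {q : V3 × V3 | q.1 ∈ S q.2}) (i j : Fin (N + 1)) :
    MeasurableSet {w : Config (N + 1) (Fin 3) T3 | ∃ k : Fin 3 → ℤ,
      Torus.reprSym ((w i).1 - (w j).1) + Torus.latticeVec k ∈ S ((w j).2 - (w i).2)} := by
  set ψ : (Fin 3 → ℤ) → Config (N + 1) (Fin 3) T3 → V3 × V3 := fun k w =>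
    (Torus.reprSym ((w i).1 - (w j).1) + Torus.latticeVec k, (w j).2 - (w i).2) with hψ
  have hψm : ∀ k, Measurable (ψ k) := by
    intro k
    refine Measurable.prodMk ?_ ?_
    · exact (Torus.measurable_reprSym.comp
        ((measurable_pi_apply i).fst.sub (measurable_pi_apply j).fst)).add_const _
    · exact (measurable_pi_apply j).snd.sub (measurable_pi_apply i).snd
  have hE' : {w : Config (N + 1) (Fin 3) T3 | ∃ k : Fin 3 → ℤ,
      Torus.reprSym ((w i).1 - (w j).1) + Torus.latticeVec k ∈ S ((w j).2 - (w i).2)} =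
      ⋃ k, ψ k ⁻¹' {q : V3 × V3 | q.1 ∈ S q.2} := by
    ext w
    simp only [hψ, mem_setOf_eq, mem_iUnion, mem_preimage]
  rw [hE']
  exact MeasurableSet.iUnion fun k => hSm.preimage (hψm k)

/-- **Static Gibbs bound for the explicit one-window event.** Under the homogeneous Gibbs law of
constant profiles `a, θ > 0`, `u` (`σ ≤ 1/2`), for a pair law at most `C_p ×` Haar measure
(`hpair`), a tube family of measurable graph and volume `≤ 4 ε² h ‖u‖` (`hSm`, `hSvol`) and the
Haar-versus-Lebesgue inequality for minimal-image lifts (`hlift`), the `A(vᵢ, vⱼ)`-weighted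
probability of the one-window event of the ordered pair `(i, j)`, `i ≠ j`, is at most
`C_p · 4 ε² h · ∫ ‖p.2 − p.1‖ A(p) d(N(u,θ) ⊗ N(u,θ))(p)` (disintegration of the rung-0 law into
positions ⊗ Gaussian velocities; the computation of `exists_windowEvent_of_pairBound`). -/
theorem lintegral_indicator_liftTubeEvent_le {σ : ℝ} (hσ2 : σ ≤ 1 / 2) {a θ : ℝ} (ha : 0 < a)
    (hθ : 0 < θ) (u : V3) {N : ℕ} (h : ℝ) {i j : Fin (N + 1)} (hij : i ≠ j) {Cp : ℝ≥0∞}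
    (hpair : ∀ T : Set T3, MeasurableSet T →
      posGibbsMeasure (fun _ : T3 => (1 : ℝ)) (hsDiameter σ N) (N + 1) {x | x i - x j ∈ T} ≤ Cp * volume T)
    {S : V3 → Set V3} (hSm : MeasurableSet {q : V3 × V3 | q.1 ∈ S q.2})
    (hSvol : ∀ u, volume (S u) ≤ ENNReal.ofReal (4 * hsDiameter σ N ^ 2 * h * ‖u‖))
    (hlift : ∀ B : Set V3, MeasurableSet B →
      volume {x : T3 | ∃ k : Fin 3 → ℤ, Torus.reprSym x + Torus.latticeVec k ∈ B} ≤ volume B)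
    (Φ : HardSphereFlow (Torus.geometry (Fin 3)) (hsDiameter σ N) (N + 1)) (A : V3 × V3 → ℝ≥0∞)
    (hA : Measurable A) :
    ∫⁻ w, {w : Config (N + 1) (Fin 3) T3 | ∃ k : Fin 3 → ℤ,
        Torus.reprSym ((w i).1 - (w j).1) + Torus.latticeVec k ∈ S ((w j).2 - (w i).2)}.indicator
        (fun w => A ((w i).2, (w j).2)) w ∂(localGibbsLaw σ (fun _ => a) (fun _ => u) (fun _ => θ) N Φ) ≤
      Cp * ENNReal.ofReal (4 * hsDiameter σ N ^ 2 * h) *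
        ∫⁻ p, ENNReal.ofReal ‖p.2 - p.1‖ * A p ∂((gaussMeasure u θ).prod (gaussMeasure u θ)) := by
  -- adapted from `exists_windowEvent_of_pairBound` (`CollisionFluxMeanBound`), for the explicit event
  set ε := hsDiameter σ N with hεdef
  set E : Set (Config (N + 1) (Fin 3) T3) := {w | ∃ k : Fin 3 → ℤ,
    Torus.reprSym ((w i).1 - (w j).1) + Torus.latticeVec k ∈ S ((w j).2 - (w i).2)} with hE
  have hEm : MeasurableSet E := measurableSet_liftTubeEvent hSm i j
  have hSu : ∀ v : V3, MeasurableSet (S v) := fun v =>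
    hSm.preimage (measurable_id.prodMk measurable_const)
  set T : (Fin (N + 1) → V3) → Set T3 := fun v =>
    {p | ∃ k : Fin 3 → ℤ, Torus.reprSym p + Torus.latticeVec k ∈ S (v j - v i)} with hT
  have hTm : ∀ v, MeasurableSet (T v) := by
    intro v
    have : T v = ⋃ k : Fin 3 → ℤ, (fun p : T3 => Torus.reprSym p + Torus.latticeVec k) ⁻¹'
        S (v j - v i) := by
      ext p; simp only [hT, mem_setOf_eq, mem_iUnion, mem_preimage]
    rw [this]
    exact MeasurableSet.iUnion fun k => (hSu _).preimage (Torus.measurable_reprSym.add_const _)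
  have hTvol : ∀ v, volume (T v) ≤ ENNReal.ofReal (4 * ε ^ 2 * h * ‖v j - v i‖) := fun v =>
    (hlift _ (hSu _)).trans (hSvol _)
  set F : Config (N + 1) (Fin 3) T3 → ℝ≥0∞ := E.indicator fun w => A ((w i).2, (w j).2) with hF
  have hAm : Measurable fun w : Config (N + 1) (Fin 3) T3 => A ((w i).2, (w j).2) :=
    hA.comp ((measurable_pi_apply i).snd.prodMk (measurable_pi_apply j).snd)
  have hFm : Measurable F := hAm.indicator hEm
  set Q := posGibbsMeasure (fun _ : T3 => a) ε (N + 1) with hQ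
  set Γ : Measure (Fin (N + 1) → V3) := Measure.pi fun _ => gaussMeasure u θ with hΓ
  have hlaw : localGibbsLaw σ (fun _ => a) (fun _ => u) (fun _ => θ) N Φ = (Q.prod Γ).map zipConfig := by
    rw [localGibbsLaw_eq, localGibbsMeasure_rung0_eq_map σ ha.le hθ u N]
  haveI : IsProbabilityMeasure Q :=
    isProbabilityMeasure_posGibbsMeasure continuous_const (fun _ => ha) hσ2 N
  haveI : IsProbabilityMeasure Γ := by rw [hΓ]; infer_instance
  have hsec : ∀ v : Fin (N + 1) → V3,
      ∫⁻ x, F (zipConfig (x, v)) ∂Q ≤ A (v i, v j) * (Cp * ENNReal.ofReal (4 * ε ^ 2 * h * ‖v j - v i‖)) := by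
    intro v
    have hle : ∀ x, F (zipConfig (x, v)) ≤ {x : Fin (N + 1) → T3 | x i - x j ∈ T v}.indicator
        (fun _ => A (v i, v j)) x := by
      intro x
      by_cases hx : zipConfig (x, v) ∈ E
      · have hx' : x ∈ {x : Fin (N + 1) → T3 | x i - x j ∈ T v} := by
          obtain ⟨k, hk⟩ := hx
          exact ⟨k, by simpa only [zipConfig_apply] using hk⟩
        rw [hF, indicator_of_mem hx, indicator_of_mem hx']
        simp only [zipConfig_apply, le_refl]
      · rw [hF, indicator_of_notMem hx]
        exact bot_le
    calc ∫⁻ x, F (zipConfig (x, v)) ∂Q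
        ≤ ∫⁻ x, {x : Fin (N + 1) → T3 | x i - x j ∈ T v}.indicator (fun _ => A (v i, v j)) x ∂Q :=
          lintegral_mono hle
      _ ≤ A (v i, v j) * Q {x | x i - x j ∈ T v} := lintegral_indicator_const_le _ _
      _ ≤ A (v i, v j) * (Cp * volume (T v)) := by
          have hQ' : Q {x | x i - x j ∈ T v} ≤ Cp * volume (T v) := by
            rw [hQ, posGibbsMeasure_const_eq_one ha]
            exact hpair _ (hTm v)
          gcongr
      _ ≤ A (v i, v j) * (Cp * ENNReal.ofReal (4 * ε ^ 2 * h * ‖v j - v i‖)) := by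
          gcongr
          exact hTvol v
  calc ∫⁻ w, F w ∂(localGibbsLaw σ (fun _ => a) (fun _ => u) (fun _ => θ) N Φ)
      = ∫⁻ pr, F (zipConfig pr) ∂(Q.prod Γ) := by rw [hlaw, lintegral_map hFm measurable_zipConfig]
    _ = ∫⁻ v, ∫⁻ x, F (zipConfig (x, v)) ∂Q ∂Γ :=
        lintegral_prod_symm _ (hFm.comp measurable_zipConfig).aemeasurable
    _ ≤ ∫⁻ v, A (v i, v j) * (Cp * ENNReal.ofReal (4 * ε ^ 2 * h * ‖v j - v i‖)) ∂Γ := lintegral_mono hsec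
    _ = ∫⁻ p, A p * (Cp * ENNReal.ofReal (4 * ε ^ 2 * h * ‖p.2 - p.1‖))
          ∂((gaussMeasure u θ).prod (gaussMeasure u θ)) := by
        rw [hΓ]
        exact lintegral_pi_pair (gaussMeasure u θ) hij
          (f := fun p : V3 × V3 => A p * (Cp * ENNReal.ofReal (4 * ε ^ 2 * h * ‖p.2 - p.1‖)))
          (hA.mul ((by fun_prop : Measurable fun p : V3 × V3 =>
            ENNReal.ofReal (4 * ε ^ 2 * h * ‖p.2 - p.1‖)).const_mul Cp))
    _ = ∫⁻ p, Cp * ENNReal.ofReal (4 * ε ^ 2 * h) * (ENNReal.ofReal ‖p.2 - p.1‖ * A p)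
          ∂((gaussMeasure u θ).prod (gaussMeasure u θ)) := by
        refine lintegral_congr fun p => ?_
        rw [show 4 * ε ^ 2 * h * ‖p.2 - p.1‖ = (4 * ε ^ 2 * h) * ‖p.2 - p.1‖ by ring]
        by_cases hh4 : 0 ≤ 4 * ε ^ 2 * h
        · rw [ENNReal.ofReal_mul hh4]
          ring
        · have hneg : 4 * ε ^ 2 * h < 0 := lt_of_not_ge hh4
          have h0 : ENNReal.ofReal (4 * ε ^ 2 * h * ‖p.2 - p.1‖) = 0 :=
            ENNReal.ofReal_of_nonpos (mul_nonpos_of_nonpos_of_nonneg hneg.le (norm_nonneg _))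
          rw [show (4 * ε ^ 2 * h) * ‖p.2 - p.1‖ = 4 * ε ^ 2 * h * ‖p.2 - p.1‖ by ring, h0,
            ENNReal.ofReal_of_nonpos hneg.le]
          simp
    _ = Cp * ENNReal.ofReal (4 * ε ^ 2 * h) *
          ∫⁻ p, ENNReal.ofReal ‖p.2 - p.1‖ * A p ∂((gaussMeasure u θ).prod (gaussMeasure u θ)) :=
        lintegral_const_mul'' _ (((by fun_prop : Measurable fun p : V3 × V3 =>
          ENNReal.ofReal ‖p.2 - p.1‖).mul hA).aemeasurable)

/-! ## Stub 3b at constant profiles -/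

/-- **The one-window energetic pair bound under the homogeneous Gibbs law** — the open stub
`stub_energeticWindowBound` (3b) of the line, in its exact shape, for the constant profiles
`a₀ ≡ 1`, `u₀ ≡ 0`, `θ₀ ≡ θe`: `σ₀ = 1/2`; `C = √(3/α)` with `α, K` the Gaussian flux-tail constants
of `exists_flux_tail_bound θe`; `S N M` the swept tubes of `exists_sweptTube` at window length
`t/M`; `B N = 5 t (K+1)/(N+2)`. Every grid term is a static Gibbs mean by invariance
(`lintegral_comp_flow_localGibbsLaw_const`), at most `(N+1)² · 5 · 4 ε_N² (t/M) · K (N+2)^{-3}`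
(`lintegral_indicator_liftTubeEvent_le` with `posGibbs_pairEvent_le_five`; for `N = 0` there is no
ordered pair and the term vanishes), i.e. `≤ B N / M`; `liminf_sum_le_of_forall_le_div`. -/
theorem equilibrium_energeticWindowBound :
    ∀ θe : ℝ, 0 < θe → ∃ σ₀ : ℝ, 0 < σ₀ ∧ ∀ σ : ℝ, 0 < σ → σ < σ₀ → ∀ t : ℝ, 0 < t → ∀ Φ : (N : ℕ) →
      Literature.Analysis.FluidPDE.HardSphereFlow (Literature.Analysis.FluidPDE.Torus.geometry (Fin
      3)) (Literature.MathematicalPhysics.KineticTheory.hsDiameter σ N) (N + 1), ∃ C : ℝ, 0 ≤ C ∧ ∃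
      S : ℕ → ℕ → Literature.MathematicalPhysics.KineticTheory.V3 → Set
      Literature.MathematicalPhysics.KineticTheory.V3, (∀ N M, MeasurableSet {q :
      Literature.MathematicalPhysics.KineticTheory.V3 ×
      Literature.MathematicalPhysics.KineticTheory.V3 | q.1 ∈ S N M q.2}) ∧ (∀ (N M : ℕ) (u r :
      Literature.MathematicalPhysics.KineticTheory.V3) (s : ℝ),
      Literature.MathematicalPhysics.KineticTheory.hsDiameter σ N ≤ ‖r‖ → s ∈ Set.Icc 0 (t / M) → ‖r
      + s • u‖ = Literature.MathematicalPhysics.KineticTheory.hsDiameter σ N → r ∈ S N M u) ∧ ∃ B :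
      ℕ → ℝ≥0∞, Filter.Tendsto B Filter.atTop (nhds 0) ∧ ∀ N : ℕ, Filter.liminf (fun M : ℕ => ∑ k ∈
      Finset.Icc 1 M, ∫⁻ z, (∑ i : Fin (N + 1), ∑ j : Fin (N + 1), (if i ≠ j then {w :
      Literature.Analysis.FluidPDE.Config (N + 1) (Fin 3)
      Literature.MathematicalPhysics.KineticTheory.T3 | ∃ k : Fin 3 → ℤ,
      Literature.Analysis.FluidPDE.Torus.reprSym ((w i).1 - (w j).1) +
      Literature.Analysis.FunctionSpaces.Torus.latticeVec k ∈ S N M ((w j).2 - (w i).2)}.indicator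
      (fun w => Set.indicator {p : Literature.MathematicalPhysics.KineticTheory.V3 ×
      Literature.MathematicalPhysics.KineticTheory.V3 | (C * Real.sqrt (Real.log ((N : ℝ) + 2))) ^ 2
      < ‖p.1‖ ^ 2 + ‖p.2‖ ^ 2} (fun _ => (1 : ℝ≥0∞)) ((w i).2, (w j).2)) ((Φ N).flow ((k : ℝ) * (t /
      M)) z) else 0)) ∂(Literature.MathematicalPhysics.KineticTheory.localGibbsLaw σ (fun _ => (1 :
      ℝ)) (fun _ => (0 : Literature.MathematicalPhysics.KineticTheory.V3)) (fun _ => θe) N (Φ N)))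
      Filter.atTop ≤ B N := by
  intro θe hθe
  refine ⟨1 / 2, by norm_num, fun σ hσ hσ2 t ht Φ => ?_⟩
  -- the Gaussian tail of the flux and the constant `C` with `α C² = 3`
  obtain ⟨α, hα, K, hK, hflux⟩ := exists_flux_tail_bound θe
  set C : ℝ := Real.sqrt (3 / α) with hC
  have hC0 : 0 ≤ C := Real.sqrt_nonneg _
  have hαC : α * C ^ 2 = 3 := by
    rw [hC, Real.sq_sqrt (by positivity)]
    field_simp
  -- the swept tubes at window length `t / M`
  have htube : ∀ N M : ℕ, ∃ S : V3 → Set V3, MeasurableSet {q : V3 × V3 | q.1 ∈ S q.2} ∧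
      (∀ u, volume (S u) ≤ ENNReal.ofReal (4 * hsDiameter σ N ^ 2 * (t / M) * ‖u‖)) ∧
      ∀ (u r : V3) (s : ℝ), hsDiameter σ N ≤ ‖r‖ → s ∈ Icc 0 (t / M) →
        ‖r + s • u‖ = hsDiameter σ N → r ∈ S u :=
    fun N M => exists_sweptTube (hsDiameter_pos hσ N) (div_nonneg ht.le (Nat.cast_nonneg M))
  choose S hSm hSvol hS using htube
  -- the rate
  set A : ℝ := 5 * t * (K.toReal + 1) with hA
  set B : ℕ → ℝ≥0∞ := fun N => ENNReal.ofReal (A / ((N : ℝ) + 2)) with hB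
  have hBlim : Tendsto B atTop (𝓝 0) := by
    rw [hB, ← ENNReal.ofReal_zero]
    refine ENNReal.tendsto_ofReal ?_
    have h : Tendsto (fun N : ℕ => (N : ℝ) + 2) atTop atTop :=
      tendsto_atTop_add_const_right _ _ tendsto_natCast_atTop_atTop
    exact h.const_div_atTop A |>.congr fun N => rfl
  refine ⟨C, hC0, S, hSm, hS, B, hBlim, fun N => ?_⟩
  -- notation for the level, the mark and the one-window events at `N`
  set c : ℝ := C * Real.sqrt (Real.log ((N : ℝ) + 2)) with hc
  set b : V3 × V3 → ℝ≥0∞ :=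
    Set.indicator {p : V3 × V3 | c ^ 2 < ‖p.1‖ ^ 2 + ‖p.2‖ ^ 2} (fun _ => (1 : ℝ≥0∞)) with hbdef
  have hbm : Measurable b :=
    measurable_const.indicator (measurableSet_lt measurable_const (by fun_prop))
  set G := localGibbsLaw σ (fun _ => (1 : ℝ)) (fun _ => (0 : V3)) (fun _ => θe) N (Φ N) with hGdef
  -- the one-window functional at mesh `t / M`
  set W : ℕ → Config (N + 1) (Fin 3) T3 → ℝ≥0∞ := fun M w => ∑ i : Fin (N + 1), ∑ j : Fin (N + 1),
    (if i ≠ j then {w : Config (N + 1) (Fin 3) T3 | ∃ k : Fin 3 → ℤ,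
        Torus.reprSym ((w i).1 - (w j).1) + Torus.latticeVec k ∈ S N M ((w j).2 - (w i).2)}.indicator
      (fun w => b ((w i).2, (w j).2)) w else 0) with hWdef
  have hWm : ∀ M, Measurable (W M) := by
    intro M
    refine Finset.measurable_sum _ fun i _ => Finset.measurable_sum _ fun j _ => ?_
    by_cases hij : i ≠ j
    · simp only [if_pos hij]
      exact (hbm.comp ((measurable_pi_apply i).snd.prodMk (measurable_pi_apply j).snd)).indicator
        (measurableSet_liftTubeEvent (hSm N M) i j)
    · simp only [if_neg hij]
      exact measurable_const
  -- the static bound on one window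
  have hflux' := hflux c
  have hexp : Real.exp (-(α * c ^ 2)) = ((N : ℝ) + 2)⁻¹ ^ 3 := by
    have hlog : 0 ≤ Real.log ((N : ℝ) + 2) := Real.log_nonneg (by linarith [(Nat.cast_nonneg N : (0 : ℝ) ≤ N)])
    rw [hc, mul_pow, Real.sq_sqrt hlog, ← mul_assoc, hαC, show (3 : ℝ) * Real.log ((N : ℝ) + 2) =
      ((3 : ℕ) : ℝ) * Real.log ((N : ℝ) + 2) by norm_num, ← Real.log_pow, Real.exp_neg,
      Real.exp_log (by positivity), inv_pow]
  have hstatic : ∀ M : ℕ, 1 ≤ M → ∫⁻ w, W M w ∂G ≤ B N / M := by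
    intro M hM
    have hM0 : (0 : ℝ) < M := by exact_mod_cast hM
    -- no ordered pair for `N = 0`
    rcases Nat.eq_zero_or_pos N with hN0 | hNpos
    · subst hN0
      have hW0 : ∀ w, W M w = 0 := by
        intro w
        simp only [hWdef]
        refine Finset.sum_eq_zero fun i _ => Finset.sum_eq_zero fun j _ => ?_
        rw [if_neg (not_not.mpr (Subsingleton.elim (α := Fin 1) i j))]
      simp only [hW0, lintegral_zero, zero_le]
    have hN1 : 1 ≤ N := hNpos
    -- each ordered pair: the static Gibbs bound with `C_p = 5`
    have hpairB : ∀ i j : Fin (N + 1), i ≠ j →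
        ∫⁻ w, {w : Config (N + 1) (Fin 3) T3 | ∃ k : Fin 3 → ℤ,
            Torus.reprSym ((w i).1 - (w j).1) + Torus.latticeVec k ∈ S N M ((w j).2 - (w i).2)}.indicator
            (fun w => b ((w i).2, (w j).2)) w ∂G ≤
          5 * ENNReal.ofReal (4 * hsDiameter σ N ^ 2 * (t / M)) *
            (K * ENNReal.ofReal (Real.exp (-(α * c ^ 2)))) := by
      intro i j hij
      have hlift : ∀ B : Set V3, MeasurableSet B →
          volume {x : T3 | ∃ k : Fin 3 → ℤ, Torus.reprSym x + Torus.latticeVec k ∈ B} ≤ volume B :=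
        fun B hB => by simpa only [sub_zero] using volume_setOf_exists_reprSym_add_latticeVec_mem_le 0 hB
      have hpair : ∀ T : Set T3, MeasurableSet T →
          posGibbsMeasure (fun _ : T3 => (1 : ℝ)) (hsDiameter σ N) (N + 1) {x | x i - x j ∈ T} ≤
            5 * volume T :=
        fun T hT => posGibbs_pairEvent_le_five hσ.le (by linarith) hN1 hij hT
      refine (lintegral_indicator_liftTubeEvent_le (by linarith) one_pos hθe (0 : V3) (t / M) hij hpair
        (hSm N M) (hSvol N M) hlift (Φ N) b hbm).trans ?_
      gcongr
    calc ∫⁻ w, W M w ∂G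
        = ∑ i : Fin (N + 1), ∑ j : Fin (N + 1), ∫⁻ w, (if i ≠ j then
            {w : Config (N + 1) (Fin 3) T3 | ∃ k : Fin 3 → ℤ,
              Torus.reprSym ((w i).1 - (w j).1) + Torus.latticeVec k ∈ S N M ((w j).2 - (w i).2)}.indicator
              (fun w => b ((w i).2, (w j).2)) w else 0) ∂G := by
          rw [hWdef, lintegral_finsetSum _ fun i _ => ?_]
          · refine Finset.sum_congr rfl fun i _ => lintegral_finsetSum _ fun j _ => ?_
            by_cases hij : i ≠ j
            · simp only [if_pos hij]
              exact (hbm.comp ((measurable_pi_apply i).snd.prodMk (measurable_pi_apply j).snd)).indicator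
                (measurableSet_liftTubeEvent (hSm N M) i j)
            · simp only [if_neg hij]
              exact measurable_const
          · refine Finset.measurable_sum _ fun j _ => ?_
            by_cases hij : i ≠ j
            · simp only [if_pos hij]
              exact (hbm.comp ((measurable_pi_apply i).snd.prodMk (measurable_pi_apply j).snd)).indicator
                (measurableSet_liftTubeEvent (hSm N M) i j)
            · simp only [if_neg hij]
              exact measurable_const
      _ ≤ ∑ _i : Fin (N + 1), ∑ _j : Fin (N + 1), 5 * ENNReal.ofReal (4 * hsDiameter σ N ^ 2 * (t / M)) *
            (K * ENNReal.ofReal (Real.exp (-(α * c ^ 2)))) := by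
          refine Finset.sum_le_sum fun i _ => Finset.sum_le_sum fun j _ => ?_
          by_cases hij : i ≠ j
          · simp only [if_pos hij]
            exact hpairB i j hij
          · simp only [if_neg hij, lintegral_zero, zero_le]
      _ = ((N + 1 : ℕ) : ℝ≥0∞) * ((N + 1 : ℕ) : ℝ≥0∞) * (5 * ENNReal.ofReal (4 * hsDiameter σ N ^ 2 * (t / M)) *
            (K * ENNReal.ofReal (Real.exp (-(α * c ^ 2))))) := by
          rw [Finset.sum_const, Finset.sum_const, Finset.card_univ, Fintype.card_fin, nsmul_eq_mul,
            nsmul_eq_mul]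
          ring
      _ ≤ B N / M := by
          -- everything is finite and real: compare in `ℝ`
          have hKofReal : K ≤ ENNReal.ofReal (K.toReal + 1) :=
            calc K = ENNReal.ofReal K.toReal := (ENNReal.ofReal_toReal hK.ne).symm
              _ ≤ ENNReal.ofReal (K.toReal + 1) := ENNReal.ofReal_le_ofReal (lt_add_one _).le
          have hεσ : hsDiameter σ N ^ 2 ≤ (1 / 2) ^ 2 :=
            pow_le_pow_left₀ (hsDiameter_pos hσ N).le ((hsDiameter_le hσ.le N).trans hσ2.le) 2
          have hN2 : (0 : ℝ) < (N : ℝ) + 2 := by positivity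
          calc ((N + 1 : ℕ) : ℝ≥0∞) * ((N + 1 : ℕ) : ℝ≥0∞) *
                (5 * ENNReal.ofReal (4 * hsDiameter σ N ^ 2 * (t / M)) *
                  (K * ENNReal.ofReal (Real.exp (-(α * c ^ 2)))))
              ≤ ENNReal.ofReal ((N + 1 : ℕ) : ℝ) * ENNReal.ofReal ((N + 1 : ℕ) : ℝ) *
                (ENNReal.ofReal 5 * ENNReal.ofReal (4 * hsDiameter σ N ^ 2 * (t / M)) *
                  (ENNReal.ofReal (K.toReal + 1) * ENNReal.ofReal (((N : ℝ) + 2)⁻¹ ^ 3))) := by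
                rw [ENNReal.ofReal_natCast, ENNReal.ofReal_ofNat, hexp]
                gcongr
            _ = ENNReal.ofReal (((N + 1 : ℕ) : ℝ) * ((N + 1 : ℕ) : ℝ) *
                (5 * (4 * hsDiameter σ N ^ 2 * (t / M)) * ((K.toReal + 1) * ((N : ℝ) + 2)⁻¹ ^ 3))) := by
                rw [← ENNReal.ofReal_mul (by positivity), ← ENNReal.ofReal_mul (by norm_num),
                  ← ENNReal.ofReal_mul (by positivity), ← ENNReal.ofReal_mul (by positivity),
                  ← ENNReal.ofReal_mul (by positivity)]
            _ ≤ ENNReal.ofReal (A / ((N : ℝ) + 2) / M) := by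
                refine ENNReal.ofReal_le_ofReal ?_
                have hN1' : ((N + 1 : ℕ) : ℝ) * ((N + 1 : ℕ) : ℝ) ≤ ((N : ℝ) + 2) ^ 2 := by
                  push_cast
                  nlinarith
                have hKt : 0 ≤ K.toReal + 1 := by positivity
                calc ((N + 1 : ℕ) : ℝ) * ((N + 1 : ℕ) : ℝ) *
                      (5 * (4 * hsDiameter σ N ^ 2 * (t / M)) * ((K.toReal + 1) * ((N : ℝ) + 2)⁻¹ ^ 3))
                    ≤ ((N : ℝ) + 2) ^ 2 *
                      (5 * (4 * (1 / 2) ^ 2 * (t / M)) * ((K.toReal + 1) * ((N : ℝ) + 2)⁻¹ ^ 3)) := by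
                      gcongr
                  _ = A / ((N : ℝ) + 2) / M := by
                      rw [hA]
                      field_simp
                      ring
            _ = B N / M := by
                rw [hB, ENNReal.ofReal_div_of_pos hM0, ENNReal.ofReal_natCast]
  -- every grid term is the static mean (invariance of `G_N`), hence `≤ B N / M`
  have hterm : ∀ M : ℕ, 1 ≤ M → ∀ k ∈ Finset.Icc 1 M,
      ∫⁻ z, W M ((Φ N).flow ((k : ℝ) * (t / M)) z) ∂G ≤ B N / M := by
    intro M hM k _
    rw [hGdef, lintegral_comp_flow_localGibbsLaw_const σ 1 θe (0 : V3) N (Φ N) _ (hWm M)]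
    exact hstatic M hM
  -- the integrand of the stub is `W M ∘ Φ_{kt/M}`
  have hshape : (fun M : ℕ => ∑ k ∈ Finset.Icc 1 M,
      ∫⁻ z, (∑ i : Fin (N + 1), ∑ j : Fin (N + 1), (if i ≠ j then
        {w : Config (N + 1) (Fin 3) T3 | ∃ k : Fin 3 → ℤ,
            Torus.reprSym ((w i).1 - (w j).1) + Torus.latticeVec k ∈ S N M ((w j).2 - (w i).2)}.indicator
          (fun w => Set.indicator {p : V3 × V3 |
              (C * Real.sqrt (Real.log ((N : ℝ) + 2))) ^ 2 < ‖p.1‖ ^ 2 + ‖p.2‖ ^ 2}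
            (fun _ => (1 : ℝ≥0∞)) ((w i).2, (w j).2))
          ((Φ N).flow ((k : ℝ) * (t / M)) z) else 0)) ∂G) =
      fun M : ℕ => ∑ k ∈ Finset.Icc 1 M, ∫⁻ z, W M ((Φ N).flow ((k : ℝ) * (t / M)) z) ∂G := by
    funext M
    rfl
  rw [hshape]
  exact liminf_sum_le_of_forall_le_div hterm

end Summit.AtomisticToContinuum.HydrodynamicLimit.Theorems.MaxSpeedBoundLogLine

end
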